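import Literature.Barriers.BirchSwinnertonDyer.RankNotSumOfLocalInvariantsCubicDescent
import Literature.Barriers.BirchSwinnertonDyer.RankNotSumOfLocalInvariantsCNProofs
import Literature.Barriers.BirchSwinnertonDyer.RankNotSumOfLocalInvariantsF5
import HarnessLib

/-!
# The ranks of `y² = x³ + (2^a 5^b)²` and the case `n = 3` of Dokchitser–Dokchitser (2011), Thm. 2

Topic `Barriers/BirchSwinnertonDyer`. The nine Mordell–Weil ranks over `ℚ` of the cubic twists
`E_t : y² = x³ + t²`, `t = 2^a 5^b`, `a, b ∈ {0, 1, 2}`, computed by the `√−3`-descent over `ℚ(ζ₃)`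
(`RankNotSumOfLocalInvariantsCubicDescent.lean`; Silverman *AEC* X.4, Exercise 10.9 — for
`y² = x³ + D` the descent via the `3`-isogeny with kernel `{O, (0, ±√D)}`; Cassels 1964):

| `t` | `1` | `2` | `4` | `5` | `10` | `20` | `25` | `50` | `100` |
|---|---|---|---|---|---|---|---|---|---|
| `rank E_t(ℚ)` | `0` | `0` | `0` | `0` | `1` | `0` | `1` | `0` | `0` |

(upper bounds `rank + 1 ≤ dim Sel`: the classes `[δ(P)] ∈ K3ˣ/K3ˣ³` are `[ζ^i 2^k 5^l]` with
`l = 0` if `5 ∤ t`, `i = 0` if `4 ∤ t` (`χ₂`), `k = 0` if `4 ∣ t` (`ord₂`), `i = 0` if `5 ∣ t` (`χ₅`),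
`l = k` if `t ≡ 5 (mod 9)` (`μ` at `λ`); lower bounds for `t = 10, 25` from the points `(5, 15)`,
`(6, 29)` and `(0, ±t)`, whose classes `1, [2t], [4t²], [Y + t]` are pairwise distinct by `2`- and
`5`-adic valuations). Hence `Σ_t rank E_t(ℚ) = 2 ≢ 0 (mod 3)` (`sum_mordellWeilRank_curve`), and:

* `not_isSumOfLocalInvariants_rankMod_three` — **the case `n = 3` of Theorem 2 of
  Dokchitser–Dokchitser (2011), UNCONDITIONALLY and K-uniformly**: the Mordell–Weil rank modulo `3`
  is not a sum of local invariants (tree `CubicTwist.not_isSumOfLocalInvariants_rankMod_three_of_sum_ne_zero`,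
  the `3`-block mechanism of Lemma 5 over `ℚ`). The printed proof uses instead `rk 480a1(F₃) = 1`
  over the degree-`9` field `F₃ ⊂ ℚ(ζ₁₃₃₉)` (Magma); this is the fixed-field evasion (iv)/(b) of
  the barrier file's audit, carried out.
* `DokchitserDokchitser2011_rankMod_notSumOfLocalInvariants_of_five`,
  `DokchitserDokchitser2011_rankMod_notSumOfLocalInvariantsNarrow_of_five` — with `n = 4`
  (`RankNotSumOfLocalInvariantsCNProofs.lean`) the entry barrier and its narrowed record are
  reduced to the single remaining case `n = 5`, i.e. (`…_of_F5`, `…_of_mordellWeilRank_F5`) to the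
  named facts `DokchitserDokchitser2011_rank_480a1_F5` / the bare rank leaf
  `DokchitserDokchitser2011_mordellWeilRank_480a1_F5` (`rk 480a1(F₅) = 1`).

## References

* T. Dokchitser, V. Dokchitser, *A note on the Mordell–Weil rank modulo `n`*, J. Number Theory
  131 (2011) 1833–1839, Thm. 2, Lemma 5. [DokchitserDokchitser2011RankModN]
* J. H. Silverman, *The Arithmetic of Elliptic Curves*, 2nd ed., GTM 106 (2009), X.4,
  Prop. X.4.9, Exercise 10.9, Remark X.4.7. [SilvermanAEC2009]
* J. W. S. Cassels, *Arithmetic on curves of genus 1. VI*, J. reine angew. Math. 214/215 (1964),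
  p. 65. [Cassels1964ArithmeticVI]
-/

noncomputable section

open scoped Classical

namespace Literature.Barriers.BirchSwinnertonDyer

namespace CubicTwist

open WeierstrassCurve Literature.NumberTheory.EllipticCurves Literature.NumberTheory.EllipticCurves.MordellDescent
  Literature.NumberTheory.NumberFields Literature.NumberTheory.NumberFields.K3

/-! ### Upper bounds -/

/-- The one-parameter families of classes used as Selmer bounds. [folklore] -/
def fam2 (k : Fin 3) : CubeUnits K3 := cubeClass ((2 : K3) ^ (k : ℕ))
/-- The one-parameter families of classes used as Selmer bounds. [folklore] -/
def famZ (i : Fin 3) : CubeUnits K3 := cubeClass ((zeta : K3) ^ (i : ℕ))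
/-- The one-parameter families of classes used as Selmer bounds. [folklore] -/
def fam5 (l : Fin 3) : CubeUnits K3 := cubeClass ((5 : K3) ^ (l : ℕ))
/-- The one-parameter families of classes used as Selmer bounds. [folklore] -/
def fam10 (k : Fin 3) : CubeUnits K3 := cubeClass ((2 : K3) ^ (k : ℕ) * 5 ^ (k : ℕ))
/-- The two-parameter family of classes used as Selmer bound for `t = 10, 25`. [folklore] -/
def fam25 (kl : Fin 3 × Fin 3) : CubeUnits K3 := cubeClass ((2 : K3) ^ (kl.1 : ℕ) * 5 ^ (kl.2 : ℕ))

/-- **`t` with `4 ∤ t`, `5 ∤ t` (`t = 1, 2`): `rank ≤ 0`** (`i = l = 0`, classes `[2^k]`).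
[cite: SilvermanAEC2009, Exercise 10.9] -/
theorem rank_le_of_le_one_zero {a : ℕ} (ha : a ≤ 1) :
    (mordellCurve (((2 ^ a * 5 ^ 0 : ℕ) : ℚ) ^ 2) : WeierstrassCurve ℚ).mordellWeilRank + 1 ≤ 1 := by
  refine rank_add_one_le_of_range_subset a 0 fam2 ?_ (by simp)
  rintro _ ⟨P, rfl⟩
  obtain ⟨s, i, k, l, w, hs, hi, hk, hl, hw, hd⟩ := exists_normalForm_delta a 0 P
  have hl0 : l = 0 := l_eq_zero hs hw hd hl rfl
  have hi0 : i = 0 := i_eq_zero_of_le_one hs hw hd hi ha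
  subst hl0 hi0
  exact ⟨⟨k, hk⟩, by rw [deltaClass_eq_of_normalForm hs hw hd, fam2]; simp⟩

/-- **`t = 4`: `rank ≤ 0`** (`k = l = 0`, classes `[ζ^i]`). [cite: SilvermanAEC2009, Exercise 10.9] -/
theorem rank_le_four :
    (mordellCurve (((2 ^ 2 * 5 ^ 0 : ℕ) : ℚ) ^ 2) : WeierstrassCurve ℚ).mordellWeilRank + 1 ≤ 1 := by
  refine rank_add_one_le_of_range_subset 2 0 famZ ?_ (by simp)
  rintro _ ⟨P, rfl⟩
  obtain ⟨s, i, k, l, w, hs, hi, hk, hl, hw, hd⟩ := exists_normalForm_delta 2 0 P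
  have hl0 : l = 0 := l_eq_zero hs hw hd hl rfl
  have hk0 : k = 0 := k_eq_zero_of_eq_two hs hw hd hk rfl
  subst hl0 hk0
  exact ⟨⟨i, hi⟩, by rw [deltaClass_eq_of_normalForm hs hw hd, famZ]; simp⟩

/-- **`t ≡ 5 (mod 9)` with `4 ∤ t` (`t = 5, 50`): `rank ≤ 0`** (`i = 0`, `l = k`, classes `[10^k]`).
[cite: SilvermanAEC2009, Exercise 10.9] -/
theorem rank_le_of_mod_nine {a b : ℕ} (ha : a ≤ 1) (ht : (2 ^ a * 5 ^ b) % 9 = 5) :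
    (mordellCurve (((2 ^ a * 5 ^ b : ℕ) : ℚ) ^ 2) : WeierstrassCurve ℚ).mordellWeilRank + 1 ≤ 1 := by
  refine rank_add_one_le_of_range_subset a b fam10 ?_ (by simp)
  rintro _ ⟨P, rfl⟩
  obtain ⟨s, i, k, l, w, hs, hi, hk, hl, hw, hd⟩ := exists_normalForm_delta a b P
  have hi0 : i = 0 := i_eq_zero_of_le_one hs hw hd hi ha
  have hlk : l = k := l_eq_k_of_two_k_add_l hk hl (two_k_add_l hs hw hd ht)
  subst hi0
  rw [hlk] at hd
  exact ⟨⟨k, hk⟩, by rw [deltaClass_eq_of_normalForm hs hw hd, fam10]; simp⟩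

/-- **`4 ∣ t`, `5 ∣ t` (`t = 20, 100`): `rank ≤ 0`** (`k = i = 0`, classes `[5^l]`).
[cite: SilvermanAEC2009, Exercise 10.9] -/
theorem rank_le_of_two_five {b : ℕ} (hb1 : 1 ≤ b) (hb2 : b ≤ 2) :
    (mordellCurve (((2 ^ 2 * 5 ^ b : ℕ) : ℚ) ^ 2) : WeierstrassCurve ℚ).mordellWeilRank + 1 ≤ 1 := by
  refine rank_add_one_le_of_range_subset 2 b fam5 ?_ (by simp)
  rintro _ ⟨P, rfl⟩
  obtain ⟨s, i, k, l, w, hs, hi, hk, hl, hw, hd⟩ := exists_normalForm_delta 2 b P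
  have hk0 : k = 0 := k_eq_zero_of_eq_two hs hw hd hk rfl
  have hi0 : i = 0 := i_eq_zero_of_five hs hw hd hi hb1 hb2
  subst hk0 hi0
  exact ⟨⟨l, hl⟩, by rw [deltaClass_eq_of_normalForm hs hw hd, fam5]; simp⟩

/-- **`4 ∤ t`, general (`t = 10, 25`): `rank ≤ 1`** (`i = 0`, classes `[2^k 5^l]`).
[cite: SilvermanAEC2009, Exercise 10.9] -/
theorem rank_le_one_of_le_one {a b : ℕ} (ha : a ≤ 1) :
    (mordellCurve (((2 ^ a * 5 ^ b : ℕ) : ℚ) ^ 2) : WeierstrassCurve ℚ).mordellWeilRank + 1 ≤ 2 := by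
  refine rank_add_one_le_of_range_subset a b fam25 ?_ (by simp)
  rintro _ ⟨P, rfl⟩
  obtain ⟨s, i, k, l, w, hs, hi, hk, hl, hw, hd⟩ := exists_normalForm_delta a b P
  have hi0 : i = 0 := i_eq_zero_of_le_one hs hw hd hi ha
  subst hi0
  exact ⟨(⟨k, hk⟩, ⟨l, hl⟩), by rw [deltaClass_eq_of_normalForm hs hw hd, fam25]; simp⟩

/-! ### Lower bounds for `t = 10` and `t = 25` -/

/-- **`t = 10`: `1 ≤ rank`**, from `(5, 15) ∈ E₁₀(ℚ)`: the classes `1`, `[20]`, `[400]`, `[25]` of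
`δ(O), δ(0, 10), δ(0, −10), δ(5, 15)` are pairwise distinct (`5`- and `2`-adic valuations).
[cite: SilvermanAEC2009, X.4 Remark X.4.7] -/
theorem one_le_rank_ten :
    1 ≤ (mordellCurve (((2 ^ 1 * 5 ^ 1 : ℕ) : ℚ) ^ 2) : WeierstrassCurve ℚ).mordellWeilRank := by
  have ht : (2 ^ 1 * 5 ^ 1 : ℕ) ≠ 0 := by norm_num
  have e1 : (((10 + (2 ^ 1 * 5 ^ 1 : ℕ) : ℤ)) : ℚ) = 20 := by norm_num
  have e2 : ((((2 * (2 ^ 1 * 5 ^ 1)) ^ 2 : ℕ)) : ℚ) = 400 := by norm_num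
  have e3 : (((15 + (2 ^ 1 * 5 ^ 1 : ℕ) : ℤ)) : ℚ) = 25 := by norm_num
  refine one_le_rank_of_four' 1 1 (x₀ := 1) (x₁ := cubeClass ((20 : ℚ) : K3))
    (x₂ := cubeClass ((400 : ℚ) : K3)) (x₃ := cubeClass ((25 : ℚ) : K3)) ?_ ?_ ?_ ?_ ?_ ?_
    (one_mem_range _) ?_ ?_ ?_
  · refine (cubeClass_ratCast_ne_one (by norm_num) (p := 5) ?_).symm
    rw [show (20 : ℚ) = (5 : ℚ) ^ 1 * (4 : ℕ) / (1 : ℕ) by norm_num,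
      show ((5 : ℚ)) = ((5 : ℕ) : ℚ) by norm_num, padicValRat_prime_pow_mul_div 1 (by norm_num) (by norm_num)]
    decide
  · refine (cubeClass_ratCast_ne_one (by norm_num) (p := 5) ?_).symm
    rw [show (400 : ℚ) = (5 : ℚ) ^ 2 * (16 : ℕ) / (1 : ℕ) by norm_num,
      show ((5 : ℚ)) = ((5 : ℕ) : ℚ) by norm_num, padicValRat_prime_pow_mul_div 2 (by norm_num) (by norm_num)]
    decide
  · refine (cubeClass_ratCast_ne_one (by norm_num) (p := 5) ?_).symm
    rw [show (25 : ℚ) = (5 : ℚ) ^ 2 * (1 : ℕ) / (1 : ℕ) by norm_num,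
      show ((5 : ℚ)) = ((5 : ℕ) : ℚ) by norm_num, padicValRat_prime_pow_mul_div 2 (by norm_num) (by norm_num)]
    decide
  · refine cubeClass_ratCast_ne (by norm_num) (by norm_num) (p := 5) ?_
    rw [show (20 : ℚ) / 400 = ((1 : ℕ) : ℚ) / ((5 : ℚ) ^ 1 * (4 : ℕ)) by norm_num,
      show ((5 : ℚ)) = ((5 : ℕ) : ℚ) by norm_num, padicValRat_div_prime_pow_mul 1 (by norm_num) (by norm_num)]
    decide
  · refine cubeClass_ratCast_ne (by norm_num) (by norm_num) (p := 5) ?_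
    rw [show (20 : ℚ) / 25 = ((4 : ℕ) : ℚ) / ((5 : ℚ) ^ 1 * (1 : ℕ)) by norm_num,
      show ((5 : ℚ)) = ((5 : ℕ) : ℚ) by norm_num, padicValRat_div_prime_pow_mul 1 (by norm_num) (by norm_num)]
    decide
  · refine cubeClass_ratCast_ne (by norm_num) (by norm_num) (p := 2) ?_
    rw [show (400 : ℚ) / 25 = (2 : ℚ) ^ 4 * (1 : ℕ) / (1 : ℕ) by norm_num,
      show ((2 : ℚ)) = ((2 : ℕ) : ℚ) by norm_num, padicValRat_prime_pow_mul_div 4 (by norm_num) (by norm_num)]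
    decide
  · rw [← e1]; exact ⟨_, deltaClass_pt _ ht 0 10 (by norm_num) (by norm_num)⟩
  · rw [← e2]; exact ⟨_, deltaClass_negT _ ht⟩
  · rw [← e3]; exact ⟨_, deltaClass_pt _ ht 5 15 (by norm_num) (by norm_num)⟩

/-- **`t = 25`: `1 ≤ rank`**, from `(6, 29) ∈ E₂₅(ℚ)`: the classes `1`, `[50]`, `[2500]`, `[54]` of
`δ(O), δ(0, 25), δ(0, −25), δ(6, 29)` are pairwise distinct. [cite: SilvermanAEC2009, X.4 Remark X.4.7] -/
theorem one_le_rank_twentyfive :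
    1 ≤ (mordellCurve (((2 ^ 0 * 5 ^ 2 : ℕ) : ℚ) ^ 2) : WeierstrassCurve ℚ).mordellWeilRank := by
  have ht : (2 ^ 0 * 5 ^ 2 : ℕ) ≠ 0 := by norm_num
  have e1 : (((25 + (2 ^ 0 * 5 ^ 2 : ℕ) : ℤ)) : ℚ) = 50 := by norm_num
  have e2 : ((((2 * (2 ^ 0 * 5 ^ 2)) ^ 2 : ℕ)) : ℚ) = 2500 := by norm_num
  have e3 : (((29 + (2 ^ 0 * 5 ^ 2 : ℕ) : ℤ)) : ℚ) = 54 := by norm_num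
  refine one_le_rank_of_four' 0 2 (x₀ := 1) (x₁ := cubeClass ((50 : ℚ) : K3))
    (x₂ := cubeClass ((2500 : ℚ) : K3)) (x₃ := cubeClass ((54 : ℚ) : K3)) ?_ ?_ ?_ ?_ ?_ ?_
    (one_mem_range _) ?_ ?_ ?_
  · refine (cubeClass_ratCast_ne_one (by norm_num) (p := 2) ?_).symm
    rw [show (50 : ℚ) = (2 : ℚ) ^ 1 * (25 : ℕ) / (1 : ℕ) by norm_num,
      show ((2 : ℚ)) = ((2 : ℕ) : ℚ) by norm_num, padicValRat_prime_pow_mul_div 1 (by norm_num) (by norm_num)]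
    decide
  · refine (cubeClass_ratCast_ne_one (by norm_num) (p := 2) ?_).symm
    rw [show (2500 : ℚ) = (2 : ℚ) ^ 2 * (625 : ℕ) / (1 : ℕ) by norm_num,
      show ((2 : ℚ)) = ((2 : ℕ) : ℚ) by norm_num, padicValRat_prime_pow_mul_div 2 (by norm_num) (by norm_num)]
    decide
  · refine (cubeClass_ratCast_ne_one (by norm_num) (p := 2) ?_).symm
    rw [show (54 : ℚ) = (2 : ℚ) ^ 1 * (27 : ℕ) / (1 : ℕ) by norm_num,
      show ((2 : ℚ)) = ((2 : ℕ) : ℚ) by norm_num, padicValRat_prime_pow_mul_div 1 (by norm_num) (by norm_num)]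
    decide
  · refine cubeClass_ratCast_ne (by norm_num) (by norm_num) (p := 2) ?_
    rw [show (50 : ℚ) / 2500 = ((1 : ℕ) : ℚ) / ((2 : ℚ) ^ 1 * (25 : ℕ)) by norm_num,
      show ((2 : ℚ)) = ((2 : ℕ) : ℚ) by norm_num, padicValRat_div_prime_pow_mul 1 (by norm_num) (by norm_num)]
    decide
  · refine cubeClass_ratCast_ne (by norm_num) (by norm_num) (p := 5) ?_
    rw [show (50 : ℚ) / 54 = (5 : ℚ) ^ 2 * (1 : ℕ) / (27 : ℕ) by norm_num,
      show ((5 : ℚ)) = ((5 : ℕ) : ℚ) by norm_num, padicValRat_prime_pow_mul_div 2 (by norm_num) (by norm_num)]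
    decide
  · refine cubeClass_ratCast_ne (by norm_num) (by norm_num) (p := 2) ?_
    rw [show (2500 : ℚ) / 54 = (2 : ℚ) ^ 1 * (625 : ℕ) / (27 : ℕ) by norm_num,
      show ((2 : ℚ)) = ((2 : ℕ) : ℚ) by norm_num, padicValRat_prime_pow_mul_div 1 (by norm_num) (by norm_num)]
    decide
  · rw [← e1]; exact ⟨_, deltaClass_pt _ ht 0 25 (by norm_num) (by norm_num)⟩
  · rw [← e2]; exact ⟨_, deltaClass_negT _ ht⟩
  · rw [← e3]; exact ⟨_, deltaClass_pt _ ht 6 29 (by norm_num) (by norm_num)⟩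

/-! ### The nine ranks and their sum -/

/-- **The ranks of `E_D`, `D = (a, b) ∈ (ℤ/3)²`** (`t = 2^a 5^b`): `1` for `t = 10, 25`, else `0`.
[cite: SilvermanAEC2009, Exercise 10.9] -/
theorem mordellWeilRank_curve (D : Idx) :
    (curve D).mordellWeilRank = if D = (1, 1) ∨ D = (0, 2) then 1 else 0 := by
  obtain ⟨a, b⟩ := D
  change (mordellCurve (((2 ^ a.val * 5 ^ b.val : ℕ) : ℚ) ^ 2)).mordellWeilRank = _
  fin_cases a <;> fin_cases b
  · -- t = 1
    rw [if_neg (by decide)]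
    change (mordellCurve (((2 ^ 0 * 5 ^ 0 : ℕ) : ℚ) ^ 2) : WeierstrassCurve ℚ).mordellWeilRank = 0
    have h := rank_le_of_le_one_zero (a := 0) (by norm_num)
    omega
  · -- t = 5
    rw [if_neg (by decide)]
    change (mordellCurve (((2 ^ 0 * 5 ^ 1 : ℕ) : ℚ) ^ 2) : WeierstrassCurve ℚ).mordellWeilRank = 0
    have h := rank_le_of_mod_nine (a := 0) (b := 1) (by norm_num) (by norm_num)
    omega
  · -- t = 25
    rw [if_pos (by decide)]
    change (mordellCurve (((2 ^ 0 * 5 ^ 2 : ℕ) : ℚ) ^ 2) : WeierstrassCurve ℚ).mordellWeilRank = 1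
    have h := rank_le_one_of_le_one (a := 0) (b := 2) (by norm_num)
    have h' := one_le_rank_twentyfive
    omega
  · -- t = 2
    rw [if_neg (by decide)]
    change (mordellCurve (((2 ^ 1 * 5 ^ 0 : ℕ) : ℚ) ^ 2) : WeierstrassCurve ℚ).mordellWeilRank = 0
    have h := rank_le_of_le_one_zero (a := 1) (by norm_num)
    omega
  · -- t = 10
    rw [if_pos (by decide)]
    change (mordellCurve (((2 ^ 1 * 5 ^ 1 : ℕ) : ℚ) ^ 2) : WeierstrassCurve ℚ).mordellWeilRank = 1
    have h := rank_le_one_of_le_one (a := 1) (b := 1) (by norm_num)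
    have h' := one_le_rank_ten
    omega
  · -- t = 50
    rw [if_neg (by decide)]
    change (mordellCurve (((2 ^ 1 * 5 ^ 2 : ℕ) : ℚ) ^ 2) : WeierstrassCurve ℚ).mordellWeilRank = 0
    have h := rank_le_of_mod_nine (a := 1) (b := 2) (by norm_num) (by norm_num)
    omega
  · -- t = 4
    rw [if_neg (by decide)]
    change (mordellCurve (((2 ^ 2 * 5 ^ 0 : ℕ) : ℚ) ^ 2) : WeierstrassCurve ℚ).mordellWeilRank = 0
    have h := rank_le_four
    omega
  · -- t = 20
    rw [if_neg (by decide)]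
    change (mordellCurve (((2 ^ 2 * 5 ^ 1 : ℕ) : ℚ) ^ 2) : WeierstrassCurve ℚ).mordellWeilRank = 0
    have h := rank_le_of_two_five (b := 1) (by norm_num) (by norm_num)
    omega
  · -- t = 100
    rw [if_neg (by decide)]
    change (mordellCurve (((2 ^ 2 * 5 ^ 2 : ℕ) : ℚ) ^ 2) : WeierstrassCurve ℚ).mordellWeilRank = 0
    have h := rank_le_of_two_five (b := 2) (by norm_num) (by norm_num)
    omega

/-- **`Σ_D rank E_D(ℚ) = 2`.** [cite: SilvermanAEC2009, Exercise 10.9] -/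
theorem sum_mordellWeilRank_curve : ∑ D : Idx, (curve D).mordellWeilRank = 2 := by
  simp_rw [mordellWeilRank_curve]
  decide

/-! ### Theorem 2 for `n = 3`; the entry barrier reduced to `n = 5` -/

/-- **The case `n = 3` of Theorem 2 of Dokchitser–Dokchitser (2011), UNCONDITIONAL and
K-uniform**: the Mordell–Weil rank modulo `3` is not a sum of local invariants — from the nine
ranks (`Σ = 2 ≢ 0 mod 3`) by the `3`-block mechanism over `ℚ`
(`not_isSumOfLocalInvariants_rankMod_three_of_sum_ne_zero`). (Printed proof: Lemma 3 with
`rk 480a1(F₃) = 1` by `2`-descent over the degree-`9` field `F₃`, Magma.)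
[cite: DokchitserDokchitser2011RankModN, Thm. 2] -/
theorem not_isSumOfLocalInvariants_rankMod_three :
    ¬ IsSumOfLocalInvariants (rankInvariant (ZMod 3)) :=
  not_isSumOfLocalInvariants_rankMod_three_of_sum_ne_zero (by rw [sum_mordellWeilRank_curve]; decide)

/-- **The entry barrier from its remaining case `n = 5`**: Theorem 2 of Dokchitser–Dokchitser for
`n = 3` (this file) and `n = 4` (`RankNotSumOfLocalInvariantsCNProofs.lean`) being proved, the
named fact `DokchitserDokchitser2011_rankMod_notSumOfLocalInvariants` follows from the case `n = 5`
alone. [cite: DokchitserDokchitser2011RankModN, Thm. 2] -/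
theorem DokchitserDokchitser2011_rankMod_notSumOfLocalInvariants_of_five
    (h₅ : ¬ IsSumOfLocalInvariants (rankInvariant (ZMod 5))) :
    DokchitserDokchitser2011_rankMod_notSumOfLocalInvariants := by
  intro n hn
  simp only [Finset.mem_insert, Finset.mem_singleton] at hn
  rcases hn with rfl | rfl | rfl
  · exact not_isSumOfLocalInvariants_rankMod_three
  · exact not_isSumOfLocalInvariants_rankMod_four
  · exact h₅

/-- **The narrowed record from the case `n = 5` alone.** [cite: DokchitserDokchitser2011RankModN, Thm. 2] -/
theorem DokchitserDokchitser2011_rankMod_notSumOfLocalInvariantsNarrow_of_five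
    (h₅ : ¬ IsSumOfLocalInvariants (rankInvariant (ZMod 5))) :
    DokchitserDokchitser2011_rankMod_notSumOfLocalInvariantsNarrow :=
  DokchitserDokchitser2011_rankMod_notSumOfLocalInvariantsNarrow_of_three_five
    not_isSumOfLocalInvariants_rankMod_three h₅

/-- **The entry barrier from the printed `F₅` computation alone**: with `n = 3, 4` proved, Theorem 2
for all `n ∈ {3, 4, 5}` follows from the single named fact `DokchitserDokchitser2011_rank_480a1_F5`
(`rk 480a1(F₅) = 1`, Magma `2`-descent over the degree-`25` field `F₅`) through the tree's Lemma 3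
(`not_isSumOfLocalInvariants_rankInvariant_of_witness`). [cite: DokchitserDokchitser2011RankModN, Thm. 2 (proof)] -/
theorem DokchitserDokchitser2011_rankMod_notSumOfLocalInvariants_of_F5
    (h₅ : DokchitserDokchitser2011_rank_480a1_F5) :
    DokchitserDokchitser2011_rankMod_notSumOfLocalInvariants := by
  refine DokchitserDokchitser2011_rankMod_notSumOfLocalInvariants_of_five ?_
  obtain ⟨F, _, _, hG, -, -, h₁, h₂, hr⟩ := h₅
  haveI := hG
  exact not_isSumOfLocalInvariants_rankInvariant_of_witness 5 F curve480a1 h₁ h₂ (by rw [hr]; decide)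

/-- **The narrowed record from the printed `F₅` computation alone.**
[cite: DokchitserDokchitser2011RankModN, Thm. 2 (proof)] -/
theorem DokchitserDokchitser2011_rankMod_notSumOfLocalInvariantsNarrow_of_F5
    (h₅ : DokchitserDokchitser2011_rank_480a1_F5) :
    DokchitserDokchitser2011_rankMod_notSumOfLocalInvariantsNarrow :=
  DokchitserDokchitser2011_rankMod_notSumOfLocalInvariantsNarrow_of_entry
    (DokchitserDokchitser2011_rankMod_notSumOfLocalInvariants_of_F5 h₅)

/-- **The entry barrier from the bare rank leaf `rk 480a1(F₅) = 1`** (the tree's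
`DokchitserDokchitser2011_mordellWeilRank_480a1_F5`, through
`DokchitserDokchitser2011_rank_480a1_F5_of_mordellWeilRank`): with `n = 3, 4` proved, this single
Magma value is all that the entry `DokchitserDokchitser2011_rankMod_notSumOfLocalInvariants` still
rests on. [cite: DokchitserDokchitser2011RankModN, Thm. 2 (proof)] -/
theorem DokchitserDokchitser2011_rankMod_notSumOfLocalInvariants_of_mordellWeilRank_F5
    (h : DokchitserDokchitser2011_mordellWeilRank_480a1_F5) :
    DokchitserDokchitser2011_rankMod_notSumOfLocalInvariants :=
  DokchitserDokchitser2011_rankMod_notSumOfLocalInvariants_of_F5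
    (DokchitserDokchitser2011_rank_480a1_F5_of_mordellWeilRank h)

/-- **The narrowed record from the bare rank leaf `rk 480a1(F₅) = 1`.**
[cite: DokchitserDokchitser2011RankModN, Thm. 2 (proof)] -/
theorem DokchitserDokchitser2011_rankMod_notSumOfLocalInvariantsNarrow_of_mordellWeilRank_F5
    (h : DokchitserDokchitser2011_mordellWeilRank_480a1_F5) :
    DokchitserDokchitser2011_rankMod_notSumOfLocalInvariantsNarrow :=
  DokchitserDokchitser2011_rankMod_notSumOfLocalInvariantsNarrow_of_F5
    (DokchitserDokchitser2011_rank_480a1_F5_of_mordellWeilRank h)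

end CubicTwist

end Literature.Barriers.BirchSwinnertonDyer

end
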